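import Literature.AlgebraicGeometry.Frobenioids.UnitsFunctorSchemaClosure
import Literature.AlgebraicGeometry.Frobenioids.UnitsFunctorProofs
import Literature.AlgebraicGeometry.Frobenioids.ArithmeticFrobenioidStandard
import Literature.AlgebraicGeometry.Frobenioids.GeometricFrobenioidStandard
import Literature.AlgebraicGeometry.Frobenioids.IrreducibleMorphismsCounterexample
import HarnessLib

/-!
# Frobenioids I, Prop. 2.2 (ii)/(iii): `UnitsFunctorExistsUnique F` and `UnitsFunctorData.DivNatural O` —
# 0-hypothesis INSTANCE FORMS at the Frobenioids of the paper (arithmetic `C_{K/F}`, geometric `C_{K̃/K}`,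
# standard `F_{ℤ≥0}`)

S. Mochizuki, *The geometry of Frobenioids I: the general theory*, Kyushu J. Math. **62** (2008) 293–400
[MochizukiFrdI2008], §2, Prop. 2.2, kurims p. 45 [cite: MochizukiFrdI2008, Prop. 2.2 p.45]: "(ii) There is a
unique contravariant functor `D* → 𝔐𝔬𝔫`, `A ↦ O^▷(A)` [with (a), (b)] … (iii) … we obtain a homomorphism
`Div : O^▷(A) → Φ(A)` which is functorial in `A`".

PROOF-ONLY companion (abc-iut cell, block F, KEY row INST59K2, seat abc-iut-f-002; 0 `def` / `structure`
/ `instance` / notation, no `Prop` fact) of `UnitsFunctor.lean` (seat abc-iut-L1-t2), FACT-LIST rows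
**F-1297** `PreFrobenioid.UnitsFunctorExistsUnique (F : C ⥤ ElemFrobenioid Φ)` (Prop. 2.2 (ii)) and
**F-1296** `PreFrobenioid.UnitsFunctorData.DivNatural (O : UnitsFunctorData F)` (Prop. 2.2 (iii),
"functorial").  State of the rows in the tree: SCHEMATA over an arbitrary structure functor `F`; universal
closures REFUTED (`PreFrobenioid.not_forall_unitsFunctorExistsUnique`, `PreFrobenioid.not_forall_divNatural`,
abc-iut-f-046, `UnitsFunctorSchemaClosure.lean`); content = the CONDITIONAL closers
`unitsFunctorExistsUnique_holds (hF : IsFrobenioid F)`, `UnitsFunctorData.divNatural_holds (hF) (O)`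
(abc-iut-L1-t2, `UnitsFunctorProofs.lean`).  The L-F kernel census (plan/LF-KERNEL-STATUS.tsv 2026-08-27,
col 14) found NO theorem whose conclusion HEAD is either decl without a hypothesis.

THIS FILE supplies those instance forms, at GENUINE data — the Frobenioids the paper itself constructs,
each a Frobenioid by a kernel theorem of the tree, so the closers apply BY NAME:
* `unitsFunctorExistsUnique_arith`, `divNatural_arith`, `divNatural_arith_unitsFunctor` — THE arithmetic
  Frobenioid `C_{K/F}` of a Galois extension of a number field (Example 6.3, `arithFrobenioid_isFrobenioid`);
  the (ii)-datum `O^▷(−)` of `C_{K/F}` exists uniquely, and `Div` is natural on all of `D*` for EVERY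
  units-functor datum `O` (an inhabited binder, by (ii)) and — binder-free in `O` — for THE datum of (ii)
  (named by `Nonempty.some`);
* `unitsFunctorExistsUnique_geom`, `divNatural_geom` — THE geometric Frobenioid `C_{K̃/K}` of Example 6.1
  (`geomFrobenioid_isFrobenioid`);
* `unitsFunctorExistsUnique_standard`, `divNatural_standard`, `divNatural_standard_unitsFunctor` — the
  STANDARD Frobenioid `F_{ℤ≥0} → F_{Φ^char}` of Def. 1.1 (iii) / Prop. 1.5
  (`StandardFrobenioidExample.isFrobenioid`): CLOSED (binder-free) certificates;
* `unitsFunctor_census_standard` — closures false ∧ instances true, side by side.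
Nothing of `UnitsFunctor.lean` is restated or edited.  [FrdI] is refereed, undisputed mathematics; an
instance-form theorem about OUR typed statement is not a theorem about IUT in print; no side taken on
[IUTchIII] Cor. 3.12.
-/

noncomputable section

namespace Literature.AlgebraicGeometry.Frobenioids

open CategoryTheory Opposite

namespace PreFrobenioid

/-! ### At THE arithmetic Frobenioid `C_{K/F}` (Example 6.3) -/

section Arith

variable (F : Type) [Field F] [NumberField F] (K : Type) [Field K] [Algebra F K] [IsGalois F K]

/-- **F-1297, INSTANCE (genuine: the arithmetic Frobenioid of a number field).** Prop. 2.2 (ii) at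
`C_{K/F}` (Example 6.3): there is exactly one contravariant functor `D* → 𝔐𝔬𝔫`, `A ↦ O^▷(A)`, with (a), (b)
(`unitsFunctorExistsUnique_holds` ∘ `arithFrobenioid_isFrobenioid`). [cite: MochizukiFrdI2008, Prop. 2.2(ii) p.45] -/
theorem unitsFunctorExistsUnique_arith :
    Literature.AlgebraicGeometry.Frobenioids.PreFrobenioid.UnitsFunctorExistsUnique
      (ModelFrobenioid.toElem (arithDivisorFunctor F K) (unitsFunctor F K) (divNatTrans F K)) :=
  unitsFunctorExistsUnique_holds (arithFrobenioid_isFrobenioid F K)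

/-- **F-1296, INSTANCE (genuine: the arithmetic Frobenioid of a number field).** Prop. 2.2 (iii),
"functorial in `A`", at `C_{K/F}`: for every units-functor datum `O` of `C_{K/F}` (there is exactly one, by
(ii)) and every arrow `f : A_D → B_D` of `D*`, `Div(O^▷(f)(β)) = f^*(Div(β))`
(`UnitsFunctorData.divNatural_holds` ∘ `arithFrobenioid_isFrobenioid`). [cite: MochizukiFrdI2008, Prop. 2.2(iii) p.45] -/
theorem divNatural_arith
    (O : UnitsFunctorData
      (ModelFrobenioid.toElem (arithDivisorFunctor F K) (unitsFunctor F K) (divNatTrans F K))) :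
    Literature.AlgebraicGeometry.Frobenioids.PreFrobenioid.UnitsFunctorData.DivNatural O :=
  UnitsFunctorData.divNatural_holds (arithFrobenioid_isFrobenioid F K) O

/-- **F-1296, INSTANCE at THE datum of (ii)** (binder-free in `O`): `Div` is natural on `D*` for THE
units functor `O^▷(−)` of `C_{K/F}` supplied by Prop. 2.2 (ii) (named by `Nonempty.some`).
[cite: MochizukiFrdI2008, Prop. 2.2(iii) p.45] -/
theorem divNatural_arith_unitsFunctor :
    Literature.AlgebraicGeometry.Frobenioids.PreFrobenioid.UnitsFunctorData.DivNatural
      (unitsFunctorExistsUnique_arith F K).1.some :=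
  divNatural_arith F K _

end Arith

/-! ### At THE geometric Frobenioid `C_{K̃/K}` (Example 6.1) -/

section Geom

variable {K : Type} [Field K] {Kt : Type} [Field Kt] [Algebra K Kt] (Γ : GeometricDivisorData K Kt)
  [IsGalois K Kt]

/-- **F-1297, INSTANCE (genuine: the geometric Frobenioid of a function field).** Prop. 2.2 (ii) at
`C_{K̃/K}` (Example 6.1): the units functor `O^▷(−)` on `D*` exists uniquely
(`unitsFunctorExistsUnique_holds` ∘ `geomFrobenioid_isFrobenioid`). [cite: MochizukiFrdI2008, Prop. 2.2(ii) p.45] -/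
theorem unitsFunctorExistsUnique_geom :
    Literature.AlgebraicGeometry.Frobenioids.PreFrobenioid.UnitsFunctorExistsUnique
      (ModelFrobenioid.toElem (geomDivisorFunctor Γ) (geomUnitsFunctor Γ) (geomDivNatTrans Γ)) :=
  unitsFunctorExistsUnique_holds (geomFrobenioid_isFrobenioid Γ)

/-- **F-1296, INSTANCE (genuine: the geometric Frobenioid of a function field).** Prop. 2.2 (iii),
"functorial", at `C_{K̃/K}`: `Div` is natural on `D*` for every units-functor datum `O`.
[cite: MochizukiFrdI2008, Prop. 2.2(iii) p.45] -/
theorem divNatural_geom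
    (O : UnitsFunctorData
      (ModelFrobenioid.toElem (geomDivisorFunctor Γ) (geomUnitsFunctor Γ) (geomDivNatTrans Γ))) :
    Literature.AlgebraicGeometry.Frobenioids.PreFrobenioid.UnitsFunctorData.DivNatural O :=
  UnitsFunctorData.divNatural_holds (geomFrobenioid_isFrobenioid Γ) O

end Geom

/-! ### At the standard Frobenioid `F_{ℤ≥0}` (Definition 1.1 (iii), Proposition 1.5) — closed certificates -/

/-- **F-1297, INSTANCE (genuine, CLOSED: the standard Frobenioid).** Prop. 2.2 (ii) for the standard
Frobenioid `F_{ℤ≥0} → F_{Φ^char}` of Def. 1.1 (iii) (a Frobenioid by Prop. 1.5,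
`StandardFrobenioidExample.isFrobenioid`): the units functor on `D*` exists uniquely.
[cite: MochizukiFrdI2008, Prop. 2.2(ii) p.45] -/
theorem unitsFunctorExistsUnique_standard :
    Literature.AlgebraicGeometry.Frobenioids.PreFrobenioid.UnitsFunctorExistsUnique
      (ElemFrobenioid.toChar StandardFrobenioidExample.Φst) :=
  unitsFunctorExistsUnique_holds StandardFrobenioidExample.isFrobenioid

/-- **F-1296, INSTANCE (genuine, CLOSED carrier: the standard Frobenioid).** Prop. 2.2 (iii), "functorial",
for the standard Frobenioid `F_{ℤ≥0}`: `Div` is natural on `D*` for every units-functor datum `O`.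
[cite: MochizukiFrdI2008, Prop. 2.2(iii) p.45] -/
theorem divNatural_standard (O : UnitsFunctorData (ElemFrobenioid.toChar StandardFrobenioidExample.Φst)) :
    Literature.AlgebraicGeometry.Frobenioids.PreFrobenioid.UnitsFunctorData.DivNatural O :=
  UnitsFunctorData.divNatural_holds StandardFrobenioidExample.isFrobenioid O

/-- **F-1296, INSTANCE (genuine, CLOSED, binder-free): `Div` is natural for THE units functor of the
standard Frobenioid** supplied by Prop. 2.2 (ii). [cite: MochizukiFrdI2008, Prop. 2.2(iii) p.45] -/
theorem divNatural_standard_unitsFunctor :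
    Literature.AlgebraicGeometry.Frobenioids.PreFrobenioid.UnitsFunctorData.DivNatural
      unitsFunctorExistsUnique_standard.1.some :=
  divNatural_standard _

/-- **Census of F-1297 / F-1296**: the universal closures over ALL structure functors are false
(`not_forall_unitsFunctorExistsUnique`, `not_forall_divNatural`), while both instance forms hold at the
standard Frobenioid. [cite: MochizukiFrdI2008, Prop. 2.2 p.45] -/
theorem unitsFunctor_census_standard :
    (¬ ∀ {D : Type} [Category.{0} D] {Φ : Dᵒᵖ ⥤ CommMonCat.{0}} {C : Type} [Category.{0} C]
        (F : C ⥤ ElemFrobenioid Φ), UnitsFunctorExistsUnique F) ∧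
      (¬ ∀ {D : Type} [Category.{0} D] {Φ : Dᵒᵖ ⥤ CommMonCat.{0}} {C : Type} [Category.{0} C]
        {F : C ⥤ ElemFrobenioid Φ} (O : UnitsFunctorData F), O.DivNatural) ∧
      UnitsFunctorExistsUnique (ElemFrobenioid.toChar StandardFrobenioidExample.Φst) ∧
      ∀ O : UnitsFunctorData (ElemFrobenioid.toChar StandardFrobenioidExample.Φst), O.DivNatural :=
  ⟨not_forall_unitsFunctorExistsUnique, not_forall_divNatural, unitsFunctorExistsUnique_standard,
    divNatural_standard⟩

end PreFrobenioid

end Literature.AlgebraicGeometry.Frobenioids
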